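import Mathlib.LinearAlgebra.Vandermonde
import Mathlib.LinearAlgebra.Matrix.NonsingularInverse
import Mathlib.LinearAlgebra.Eigenspace.Basic
import Mathlib.Algebra.Polynomial.Eval.Degree
import Mathlib.Analysis.Real.Sqrt
import Literature.AlgebraicGeometry.Motives.AbelianVarietyProduct
import Literature.AlgebraicGeometry.Motives.AbelianVarietyCohomologyExteriorH1
import Literature.AlgebraicGeometry.Motives.AimedSplitProductProofs
import HarnessLib

/-!
# Untwisting for the real-quadratic base change of a `ℚ(√-7)`-Weil sixfold — lemmas

Route `HeckePrymWeil` of the Hodge summit, crux `WeilSixfoldsSqrtMinus7` (stmt-HodgeConjecture-1260),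
line `real-quadratic-base-change`, helper file for the stub `stub_untwisting` (file
`HeckePrymWeilWeilSixfoldsSqrtMinus7Untwisting`): the `K`-Weil classes of a sixfold `(A, φ)` are
algebraic as soon as the `L`-Weil classes of the base change `A ⊗ O_F = A × A` (`F = ℚ(√t)`,
`L = ℚ(√-7, √t)`) are (B. van Geemen, LNM 1594 (1994), 4.9 and the proof of Thm. 6.12:
`W_K(A) ⊗ F = W_L(A ⊗ O_F)`). This file collects the generic ingredients, all proved:

* linear algebra: Vandermonde uniqueness with vector coefficients and rational Vandermonde
  interpolation (`eq_zero_of_forall_sum_pow_smul_eq_zero`, `exists_rat_weights`; Mathlib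
  `Matrix.det_vandermonde_ne_zero_iff`), the `F`-eigenvectors `Σ_k (±√t)^k C_k` of an operator acting
  on a polynomial family through `(1+X)^{6-j}(t+X)^j` (`sum_pow_smul_mem_eigenspace`), joint eigenspaces
  of two commuting operators (`mem_inf_sup_inf_of_commute`), `(1+√t)⁶ ≠ (1-√t)⁶` for `t > 0`, and the
  rationality of the power sums `(√t)^k + (-√t)^k`;
* category identities on `A × A` (`Preadditive` structure of `Motives/AbelianVariety`, projections and
  pairing of `Motives/AbelianVarietyProduct`): `(𝟙 + ψ_K) ≫ (a•fst + b•snd) = (a•fst + b•snd) ≫ (𝟙 + φ)`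
  for `ψ_K = φ × φ`, `(𝟙 + ψ_F) ≫ (a•fst + b•snd) = (a+b)•fst + (ta+b)•snd` for `ψ_F = (t•snd, fst)`,
  `(𝟙, 0) ≫ (a•fst + b•snd) = a•𝟙`, and `ψ_K ψ_F = ψ_F ψ_K`;
* cohomology: POLYNOMIALITY `(a•fst + b•snd)^* y = Σ_k a^{d-k} b^k • C_k` on `Hᵈ(A(ℂ); ℂ) = ⋀ᵈ H¹`
  (`exists_coeff_map_nsmul_fst_add_nsmul_snd`; the tree's theorems `abelianVarietyCohomologyExteriorH1_holds` (Hopf),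
  `complexBetti_map_cupPowOne`, `complexBetti_map_add_deg_one` — `H¹` is primitive, Mumford §1), and
  the resulting `K`-part / `F`-part / section identities for pull-backs (no Künneth needed).

Everything is proved; no definition and no named fact is introduced. Relies on: nothing unproved.

## References

* [vanGeemen1994HodgeAV] B. van Geemen, An introduction to the Hodge conjecture for abelian
  varieties, LNM 1594 (1994), 4.9, Lemma 5.2, Thm. 6.12.
* [MumfordAV1970] D. Mumford, Abelian Varieties (1970), §1.
* [LangeBirkenhake1992] H. Lange, Ch. Birkenhake, Complex Abelian Varieties (1992), Lemma 1.1.17.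
-/

noncomputable section
-- single-problem summit (Problem = Summit): the mandated namespace repeats `HodgeConjecture`.
set_option linter.dupNamespace false

open CategoryTheory Polynomial

namespace Summit.HodgeConjecture.HodgeConjecture.Theorems.WeilSixfoldsSqrtMinus7.RealQuadraticBaseChange

section LinearAlgebra

/-! ### Linear algebra: Vandermonde bookkeeping and joint eigenspaces -/

/-- **Vandermonde uniqueness with vector coefficients**: if `Σ_k n^k • D_k = 0` for the `N` nodes
`n = 0, …, N-1`, then every `D_k` vanishes (the Vandermonde matrix of distinct nodes is invertible,
Mathlib `Matrix.det_vandermonde_ne_zero_iff`). [folklore] -/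
theorem eq_zero_of_forall_sum_pow_smul_eq_zero {V : Type*} [AddCommGroup V] [Module ℂ V] {N : ℕ}
    (D : Fin N → V) (h : ∀ n : Fin N, ∑ k : Fin N, (((n : ℕ) : ℂ) ^ (k : ℕ)) • D k = 0) (k : Fin N) :
    D k = 0 := by
  set M : Matrix (Fin N) (Fin N) ℂ := Matrix.vandermonde (fun i : Fin N => ((i : ℕ) : ℂ)) with hM_def
  have hM : IsUnit M.det := by
    rw [isUnit_iff_ne_zero, hM_def, Matrix.det_vandermonde_ne_zero_iff]
    exact fun i j hij => Fin.ext (Nat.cast_injective (R := ℂ) hij)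
  have key : D k = ∑ j, (M⁻¹ * M) k j • D j := by
    rw [Matrix.nonsing_inv_mul _ hM]
    simp only [Matrix.one_apply, ite_smul, one_smul, zero_smul, Finset.sum_ite_eq, Finset.mem_univ,
      if_true]
  rw [key]
  simp_rw [Matrix.mul_apply, Finset.sum_smul, mul_smul]
  rw [Finset.sum_comm]
  simp only [← Finset.smul_sum, hM_def, Matrix.vandermonde_apply, h, smul_zero, Finset.sum_const_zero]

/-- **Rational Vandermonde interpolation**: for prescribed rational values `s_k` there are rational
weights `a_m` with `Σ_m a_m m^k = s_k` for all `k < N` (the transpose Vandermonde system of the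
distinct nodes `0, …, N-1` is invertible over `ℚ`). [folklore] -/
theorem exists_rat_weights {N : ℕ} (s : Fin N → ℚ) :
    ∃ a : Fin N → ℚ, ∀ k : Fin N, ∑ m : Fin N, a m * ((m : ℕ) : ℚ) ^ (k : ℕ) = s k := by
  set M : Matrix (Fin N) (Fin N) ℚ := Matrix.vandermonde (fun i : Fin N => ((i : ℕ) : ℚ)) with hM_def
  have hM : IsUnit M.transpose.det := by
    rw [Matrix.det_transpose, isUnit_iff_ne_zero, hM_def, Matrix.det_vandermonde_ne_zero_iff]
    exact fun i j hij => Fin.ext (Nat.cast_injective (R := ℚ) hij)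
  refine ⟨(M.transpose)⁻¹.mulVec s, fun k => ?_⟩
  have h : M.transpose.mulVec ((M.transpose)⁻¹.mulVec s) = s := by
    rw [Matrix.mulVec_mulVec, Matrix.mul_nonsing_inv _ hM, Matrix.one_mulVec]
  conv_rhs => rw [← h]
  rw [Matrix.mulVec, dotProduct]
  refine Finset.sum_congr rfl fun m _ => ?_
  rw [Matrix.transpose_apply, hM_def, Matrix.vandermonde_apply, mul_comm]

/-- Exchange of a weighted double sum: `Σ_m w_m • Σ_k e_{mk} • C_k = Σ_k (Σ_m w_m e_{mk}) • C_k`.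
[folklore] -/
theorem sum_smul_sum_smul_eq {V : Type*} [AddCommMonoid V] [Module ℂ V] {ι κ : Type*} [Fintype ι]
    [Fintype κ] (w : ι → ℂ) (e : ι → κ → ℂ) (C' : κ → V) :
    ∑ m, w m • ∑ k, e m k • C' k = ∑ k, (∑ m, w m * e m k) • C' k := by
  simp_rw [Finset.smul_sum, smul_smul, Finset.sum_smul]
  rw [Finset.sum_comm]

/-- The polynomials `P_j = (X + 1)^{6-j} (X + t)^j` (`j ≤ 6`) have degree `≤ 6`, so they are read off
from their first seven coefficients: `Σ_{k<7} coeff_k(P_j) z^k = (z + 1)^{6-j} (z + t)^j`. [folklore] -/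
theorem sum_coeff_mul_pow_seven (t : ℂ) (j : Fin 7) (z : ℂ) :
    ∑ k : Fin 7, ((X + C (1 : ℂ)) ^ (6 - (j : ℕ)) * (X + C t) ^ (j : ℕ)).coeff (k : ℕ) * z ^ (k : ℕ) =
      (z + 1) ^ (6 - (j : ℕ)) * (z + t) ^ (j : ℕ) := by
  set p : ℂ[X] := (X + C (1 : ℂ)) ^ (6 - (j : ℕ)) * (X + C t) ^ (j : ℕ) with hp
  have hdeg : p.natDegree < 7 := by
    have hj := j.isLt
    have h1 : ((X + C (1 : ℂ)) ^ (6 - (j : ℕ))).natDegree ≤ (6 - (j : ℕ)) * 1 :=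
      natDegree_pow_le_of_le _ (by rw [natDegree_X_add_C])
    have h2 : ((X + C t) ^ (j : ℕ)).natDegree ≤ (j : ℕ) * 1 :=
      natDegree_pow_le_of_le _ (by rw [natDegree_X_add_C])
    have h3 := (natDegree_mul_le (p := (X + C (1 : ℂ)) ^ (6 - (j : ℕ)))
      (q := (X + C t) ^ (j : ℕ))).trans (add_le_add h1 h2)
    rw [hp]
    omega
  rw [Fin.sum_univ_eq_sum_range (fun k => p.coeff k * z ^ k) 7, ← eval_eq_sum_range' hdeg z, hp]
  simp only [eval_mul, eval_pow, eval_add, eval_X, eval_C]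

/-- **The `F`-eigenvectors of a polynomial family (abstract form of van Geemen's
`W_K ⊗ F = W_L`).** Let `T` be a linear operator and `C_0, …, C_6` vectors with
`T (Σ_k n^k • C_k) = Σ_k (1+n)^{6-k} (t+n)^k • C_k` for the seven nodes `n = 0, …, 6`. Then for every
square root `r` of `t`, `x_r = Σ_k r^k • C_k` is a `T`-eigenvector for `(1 + r)⁶`. Proof: by Vandermonde,
`T C_k = Σ_j e_{kj} • C_j` with `e_{kj}` the coefficients of `P_j = (1+X)^{6-j}(t+X)^j`, and
`P_j(r) = (1+r)^{6-j} (t+r)^j = (1+r)^6 r^j` since `t + r = r (1 + r)`.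
[cite: vanGeemen1994HodgeAV, 4.9 and Thm. 6.12] -/
theorem sum_pow_smul_mem_eigenspace {V : Type*} [AddCommGroup V] [Module ℂ V] (T : Module.End ℂ V)
    (t : ℂ) (C' : Fin 7 → V)
    (hT : ∀ n : Fin 7, T (∑ k : Fin 7, (((n : ℕ) : ℂ) ^ (k : ℕ)) • C' k) =
      ∑ k : Fin 7, ((1 + ((n : ℕ) : ℂ)) ^ (6 - (k : ℕ)) * (t + ((n : ℕ) : ℂ)) ^ (k : ℕ)) • C' k)
    (r : ℂ) (hr : r ^ 2 = t) :
    ∑ k : Fin 7, (r ^ (k : ℕ)) • C' k ∈ T.eigenspace ((1 + r) ^ 6) := by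
  -- the matrix of `T` on the `C' k`
  set e : Fin 7 → Fin 7 → ℂ :=
    fun k j => ((X + C (1 : ℂ)) ^ (6 - (j : ℕ)) * (X + C t) ^ (j : ℕ)).coeff (k : ℕ)
  have hev : ∀ (z : ℂ) (j : Fin 7), ∑ k : Fin 7, z ^ (k : ℕ) * e k j =
      (1 + z) ^ (6 - (j : ℕ)) * (t + z) ^ (j : ℕ) := by
    intro z j
    rw [add_comm 1 z, add_comm t z, ← sum_coeff_mul_pow_seven t j z]
    exact Finset.sum_congr rfl fun k _ => mul_comm _ _
  have hTC : ∀ k, T (C' k) = ∑ j, e k j • C' j := by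
    intro k
    rw [← sub_eq_zero]
    refine eq_zero_of_forall_sum_pow_smul_eq_zero (fun k => T (C' k) - ∑ j, e k j • C' j)
      (fun n => ?_) k
    simp_rw [smul_sub, Finset.sum_sub_distrib]
    rw [sum_smul_sum_smul_eq, sub_eq_zero]
    have h1 : ∑ k : Fin 7, (((n : ℕ) : ℂ) ^ (k : ℕ)) • T (C' k) =
        T (∑ k : Fin 7, (((n : ℕ) : ℂ) ^ (k : ℕ)) • C' k) := by
      rw [map_sum]
      simp_rw [map_smul]
    rw [h1, hT n]
    exact Finset.sum_congr rfl fun j _ => by rw [hev]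
  rw [Module.End.mem_eigenspace_iff, map_sum]
  simp_rw [map_smul, hTC]
  rw [sum_smul_sum_smul_eq, Finset.smul_sum]
  refine Finset.sum_congr rfl fun j _ => ?_
  rw [hev, smul_smul]
  congr 1
  have hj : (j : ℕ) ≤ 6 := Nat.lt_succ_iff.1 j.isLt
  have hrt : t + r = r * (1 + r) := by rw [← hr]; ring
  rw [hrt, mul_pow, ← mul_assoc, mul_comm ((1 + r) ^ _) (r ^ _), mul_assoc, ← pow_add,
    Nat.sub_add_cancel hj, mul_comm]

/-- **Joint eigenspace decomposition for two commuting operators**: if `f g` commute, `β ≠ γ`,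
`f x = α x` and `x ∈ Eig(g, β) ⊔ Eig(g, γ)`, then `x ∈ (Eig(f, α) ⊓ Eig(g, β)) ⊔ (Eig(f, α) ⊓ Eig(g, γ))`
— the `g`-components `(β-γ)⁻¹ (g - γ) x`, `(γ-β)⁻¹ (g - β) x` are polynomials in `g` applied to `x`.
[folklore] -/
theorem mem_inf_sup_inf_of_commute {V : Type*} [AddCommGroup V] [Module ℂ V] {f g : Module.End ℂ V}
    (hfg : Commute f g) {α β γ : ℂ} (hβγ : β ≠ γ) {x : V} (hf : x ∈ f.eigenspace α)
    (hg : x ∈ g.eigenspace β ⊔ g.eigenspace γ) :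
    x ∈ (f.eigenspace α ⊓ g.eigenspace β) ⊔ (f.eigenspace α ⊓ g.eigenspace γ) := by
  obtain ⟨u, hu, w, hw, rfl⟩ := Submodule.mem_sup.1 hg
  rw [Module.End.mem_eigenspace_iff] at hu hw hf
  have hd : β - γ ≠ 0 := sub_ne_zero.2 hβγ
  have hu' : u = (β - γ)⁻¹ • (g (u + w) - γ • (u + w)) := by
    rw [map_add, hu, hw, smul_add,
      show β • u + γ • w - (γ • u + γ • w) = (β - γ) • u by module, smul_smul, inv_mul_cancel₀ hd,
      one_smul]
  have hfu : f u = α • u := by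
    rw [hu', map_smul, map_sub, map_smul, ← Module.End.mul_apply, hfg.eq, Module.End.mul_apply, hf,
      map_smul]
    module
  have hfw : f w = α • w := by
    rw [map_add, hfu, smul_add] at hf
    exact add_left_cancel hf
  exact Submodule.mem_sup.2 ⟨u, ⟨Module.End.mem_eigenspace_iff.2 hfu, Module.End.mem_eigenspace_iff.2 hu⟩,
    w, ⟨Module.End.mem_eigenspace_iff.2 hfw, Module.End.mem_eigenspace_iff.2 hw⟩, rfl⟩

/-- **The two `F`-eigenvalues are distinct**: `(1 + √t)⁶ ≠ (1 - √t)⁶` for `t > 0`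
(`|1 - √t| < 1 + √t`, compare sixth powers of reals). [folklore] -/
theorem one_add_sqrt_pow_six_ne (t : ℕ) (ht : 0 < t) :
    (1 + ((Real.sqrt t : ℝ) : ℂ)) ^ 6 ≠ (1 - ((Real.sqrt t : ℝ) : ℂ)) ^ 6 := by
  have hs : 0 < Real.sqrt t := Real.sqrt_pos.2 (by exact_mod_cast ht)
  have hlt : (1 - Real.sqrt t) ^ 6 < (1 + Real.sqrt t) ^ 6 := by
    rw [← (by decide : Even 6).pow_abs (1 - Real.sqrt t)]
    refine pow_lt_pow_left₀ ?_ (abs_nonneg _) (by norm_num)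
    rw [abs_lt]; constructor <;> linarith
  intro h
  have h' : ((1 + Real.sqrt t) ^ 6 : ℝ) = (1 - Real.sqrt t) ^ 6 := by exact_mod_cast h
  exact hlt.ne' h'

/-- **The power sums `(√t)^k + (-√t)^k` are rational**: `2 t^{k/2}` for even `k`, `0` for odd `k`.
[folklore] -/
theorem sqrt_pow_add_neg_sqrt_pow (t k : ℕ) :
    ((Real.sqrt t : ℝ) : ℂ) ^ k + (-((Real.sqrt t : ℝ) : ℂ)) ^ k =
      ((if Even k then 2 * (t : ℚ) ^ (k / 2) else 0 : ℚ) : ℂ) := by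
  have hsq : ((Real.sqrt t : ℝ) : ℂ) ^ 2 = (t : ℂ) := by
    rw [← Complex.ofReal_pow, Real.sq_sqrt (Nat.cast_nonneg _), Complex.ofReal_natCast]
  rcases Nat.even_or_odd k with ⟨j, rfl⟩ | hk
  · have hj : (j + j) / 2 = j := by omega
    rw [if_pos ⟨j, rfl⟩, hj, Even.neg_pow ⟨j, rfl⟩, ← two_mul, ← two_mul, pow_mul, hsq]
    push_cast
    ring
  · rw [if_neg (Nat.not_even_iff_odd.2 hk), Odd.neg_pow hk, add_neg_cancel]
    push_cast
    rfl

end LinearAlgebra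

open Literature.AlgebraicGeometry.Motives Literature.AlgebraicGeometry.HodgeTheory
open Literature.AlgebraicGeometry.Motives.AbelianVariety
open Literature.AlgebraicTopology.SingularHomology

/-! ### Category identities on `A × A` (all coefficients natural numbers) -/

section Geometry

variable {A : AbelianVariety ℂ}

/-- `(𝟙 + ψ_K) ≫ (a • fst + b • snd) = (a • fst + b • snd) ≫ (𝟙 + φ)` for `ψ_K = φ × φ`
(composition is bilinear; `ψ_K ≫ fst = fst ≫ φ`, `ψ_K ≫ snd = snd ≫ φ`). [folklore] -/
theorem psiK_comp_linComb (φ : A ⟶ A) (a b : ℕ) :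
    (𝟙 (A.prod A) + prodLift (fst A A ≫ φ) (snd A A ≫ φ)) ≫ (a • fst A A + b • snd A A) =
      (a • fst A A + b • snd A A) ≫ (𝟙 A + φ) := by
  simp only [Preadditive.add_comp, Preadditive.comp_add, Preadditive.comp_nsmul,
    Preadditive.nsmul_comp, Category.id_comp, Category.comp_id, prodLift_fst, prodLift_snd, smul_add]
  abel

/-- `(𝟙 + ψ_F) ≫ (a • fst + b • snd) = (a + b) • fst + (t a + b) • snd` for `ψ_F = (t • snd, fst)`
(`ψ_F ≫ fst = t • snd`, `ψ_F ≫ snd = fst`). [folklore] -/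
theorem psiF_comp_linComb (t a b : ℕ) :
    (𝟙 (A.prod A) + prodLift ((t : ℤ) • snd A A) (fst A A)) ≫ (a • fst A A + b • snd A A) =
      (a + b) • fst A A + (t * a + b) • snd A A := by
  simp only [Preadditive.add_comp, Preadditive.comp_add, Preadditive.comp_nsmul,
    Category.id_comp, prodLift_fst, prodLift_snd, natCast_zsmul]
  module

/-- The section `ι = (𝟙, 0) : A ⟶ A × A` satisfies `ι ≫ (a • fst + b • snd) = a • 𝟙 A`. [folklore] -/
theorem section_comp_linComb (a b : ℕ) :
    prodLift (𝟙 A) (0 : A ⟶ A) ≫ (a • fst A A + b • snd A A) = a • 𝟙 A := by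
  simp only [Preadditive.comp_add, Preadditive.comp_nsmul, prodLift_fst, prodLift_snd, smul_zero,
    add_zero]

/-- `(𝟙 + ψ_K)` and `(𝟙 + ψ_F)` commute (`ψ_K ψ_F = ψ_F ψ_K`: both have components
`(t • snd ≫ φ, fst ≫ φ)`; `L = K F` is commutative). [folklore] -/
theorem one_add_psiK_comm_one_add_psiF (φ : A ⟶ A) (t : ℕ) :
    (𝟙 (A.prod A) + prodLift (fst A A ≫ φ) (snd A A ≫ φ)) ≫
        (𝟙 (A.prod A) + prodLift ((t : ℤ) • snd A A) (fst A A)) =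
      (𝟙 (A.prod A) + prodLift ((t : ℤ) • snd A A) (fst A A)) ≫
        (𝟙 (A.prod A) + prodLift (fst A A ≫ φ) (snd A A ≫ φ)) := by
  have hc : prodLift (fst A A ≫ φ) (snd A A ≫ φ) ≫ prodLift ((t : ℤ) • snd A A) (fst A A) =
      prodLift ((t : ℤ) • snd A A) (fst A A) ≫ prodLift (fst A A ≫ φ) (snd A A ≫ φ) := by
    apply prod_hom_ext
    · rw [Category.assoc, prodLift_fst, Preadditive.comp_zsmul, prodLift_snd, Category.assoc,
        prodLift_fst, ← Category.assoc, prodLift_fst, Preadditive.zsmul_comp]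
    · rw [Category.assoc, prodLift_snd, prodLift_fst, Category.assoc, prodLift_snd, ← Category.assoc,
        prodLift_snd]
  simp only [Preadditive.add_comp, Preadditive.comp_add, Category.id_comp, Category.comp_id, hc]
  abel

/-! ### Cohomology of `A × A`: polynomiality of `(a • fst + b • snd)^*` and the eigen-parts -/

/-- Piecewise choice of two scaled families is the scaled piecewise family. [folklore] -/
theorem piecewise_smul_smul {ι M : Type*} [AddCommMonoid M] [Module ℂ M] [DecidableEq ι]
    (s : Finset ι) (a b : ℂ) (F G : ι → M) :
    s.piecewise (fun i => b • G i) (fun i => a • F i) =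
      fun i => s.piecewise (fun _ => b) (fun _ => a) i • s.piecewise G F i := by
  funext i
  by_cases hi : i ∈ s
  · simp only [Finset.piecewise_eq_of_mem _ _ _ hi]
  · simp only [Finset.piecewise_eq_of_notMem _ _ _ hi]

/-- `∏_i (b on s, a off s) = a^{d - #s} b^{#s}` on `Fin d`. [folklore] -/
theorem prod_piecewise_const {d : ℕ} (s : Finset (Fin d)) (a b : ℂ) :
    ∏ i, s.piecewise (fun _ => b) (fun _ => a) i = a ^ (d - s.card) * b ^ s.card := by
  classical
  rw [Finset.prod_piecewise, Finset.univ_inter, Finset.prod_const, Finset.prod_const,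
    ← Finset.compl_eq_univ_sdiff, Finset.card_compl, Fintype.card_fin, mul_comm]

/-- **Polynomiality of `(a • fst + b • snd)^*` on products of degree-one classes**: for
`v_0, …, v_{d-1} ∈ H¹(A(ℂ); ℂ)` there are classes `C_k ∈ Hᵈ((A × A)(ℂ); ℂ)` with
`(a • fst + b • snd)^* (v_0 ⌣ ⋯ ⌣ v_{d-1}) = Σ_k a^{d-k} b^k • C_k` for all `a, b ∈ ℕ`: pull-back is
multiplicative (`complexBetti_map_cupPowOne`), `(a • fst + b • snd)^* v = a • fst^* v + b • snd^* v` on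
`H¹` (`complexBetti_map_add_deg_one`, `complexBetti_map_nsmul_deg_one`; Mumford §1: `H¹` is primitive),
and the iterated cup product is multilinear (`MultilinearMap.map_add_univ`, `map_smul_univ`); group
the `2ᵈ` terms by the number `k` of `snd`-factors. [cite: MumfordAV1970, §1] -/
theorem exists_coeff_map_linComb_cupPowOne (A : AbelianVariety ℂ) (d : ℕ)
    (v : Fin d → complexBetti A.X 1) :
    ∃ C : Fin (d + 1) → complexBetti (A.prod A).X d, ∀ a b : ℕ,
      complexBetti.map (a • fst A A + b • snd A A).hom.hom.hom d (cupPowOne ℂ (ComplexPoints A.X) d v) =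
        ∑ k : Fin (d + 1), ((a : ℂ) ^ (d - (k : ℕ)) * (b : ℂ) ^ (k : ℕ)) • C k := by
  classical
  set F : Fin d → complexBetti (A.prod A).X 1 := fun i => complexBetti.map (fst A A).hom.hom.hom 1 (v i)
  set G : Fin d → complexBetti (A.prod A).X 1 := fun i => complexBetti.map (snd A A).hom.hom.hom 1 (v i)
  refine ⟨fun k => ∑ s ∈ Finset.univ.filter (fun s : Finset (Fin d) => s.card = (k : ℕ)),
    cupPowOne ℂ (ComplexPoints (A.prod A).X) d (s.piecewise G F), fun a b => ?_⟩
  rw [complexBetti_map_cupPowOne]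
  have h1 : (fun i => complexBetti.map (a • fst A A + b • snd A A).hom.hom.hom 1 (v i)) =
      (fun i => (b : ℂ) • G i) + (fun i => (a : ℂ) • F i) := by
    funext i
    simp only [Pi.add_apply]
    rw [complexBetti_map_add_deg_one, complexBetti_map_nsmul_deg_one, complexBetti_map_nsmul_deg_one,
      ← Nat.cast_smul_eq_nsmul ℂ, ← Nat.cast_smul_eq_nsmul ℂ, add_comm]
  rw [h1, MultilinearMap.map_add_univ]
  simp_rw [piecewise_smul_smul, MultilinearMap.map_smul_univ, prod_piecewise_const]
  -- regroup the sum over `s` by the cardinality of `s`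
  rw [Fin.sum_univ_eq_sum_range (fun j => ((a : ℂ) ^ (d - j) * (b : ℂ) ^ j) •
    ∑ s ∈ Finset.univ.filter (fun s : Finset (Fin d) => s.card = j),
      cupPowOne ℂ (ComplexPoints (A.prod A).X) d (s.piecewise G F)) (d + 1)]
  simp_rw [Finset.smul_sum]
  rw [← Finset.sum_fiberwise_of_maps_to (s := Finset.univ) (t := Finset.range (d + 1))
    (g := fun s : Finset (Fin d) => s.card)
    (fun s _ => Finset.mem_range.2 (Nat.lt_succ_of_le (by simpa using s.card_le_univ)))]
  refine Finset.sum_congr rfl fun j _ => Finset.sum_congr rfl fun s hs => ?_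
  rw [(Finset.mem_filter.1 hs).2]

/-- **Polynomiality of `(a • fst + b • snd)^*` on `Hᵈ(A(ℂ); ℂ)`**: for every `y ∈ Hᵈ(A(ℂ); ℂ)` there
are classes `C_0, …, C_d ∈ Hᵈ((A × A)(ℂ); ℂ)` with `(a • fst + b • snd)^* y = Σ_k a^{d-k} b^k • C_k`
for all `a, b ∈ ℕ` — `Hᵈ(A(ℂ); ℂ)` is spanned by products of degree-one classes
(`abelianVarietyCohomologyExteriorH1_holds`, Lange–Birkenhake Lemma 1.1.17 / Exercise 1.1.6 (7)),
and the set of such `y` is a subspace. [cite: LangeBirkenhake1992, Lemma 1.1.17 and Exercise 1.1.6 (7)] -/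
theorem exists_coeff_map_nsmul_fst_add_nsmul_snd :
    ∀ (A : AbelianVariety ℂ) (d : ℕ) (y : complexBetti A.X d),
      ∃ C : Fin (d + 1) → complexBetti (A.prod A).X d, ∀ a b : ℕ,
        complexBetti.map (a • fst A A + b • snd A A).hom.hom.hom d y =
          ∑ k : Fin (d + 1), ((a : ℂ) ^ (d - (k : ℕ)) * (b : ℂ) ^ (k : ℕ)) • C k := by
  intro A d y
  have hy : y ∈ Submodule.span ℂ (Set.range (cupPowOne ℂ (ComplexPoints A.X) d)) := by
    rw [abelianVarietyCohomologyExteriorH1_holds.span_range_cupPowOne A d]; trivial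
  induction hy using Submodule.span_induction with
  | mem x hx =>
    obtain ⟨v, rfl⟩ := hx
    exact exists_coeff_map_linComb_cupPowOne A d v
  | zero =>
    exact ⟨0, fun a b => by simp only [map_zero, Pi.zero_apply, smul_zero, Finset.sum_const_zero]⟩
  | add x y _ _ hx hy =>
    obtain ⟨C, hC⟩ := hx
    obtain ⟨D, hD⟩ := hy
    refine ⟨C + D, fun a b => ?_⟩
    rw [map_add, hC, hD, ← Finset.sum_add_distrib]
    simp only [Pi.add_apply, smul_add]
  | smul r x _ hx =>
    obtain ⟨C, hC⟩ := hx
    refine ⟨r • C, fun a b => ?_⟩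
    rw [map_smul, hC, Finset.smul_sum]
    simp only [Pi.smul_apply, smul_comm r]

/-- **`K`-part**: `(a • fst + b • snd)^*` maps the `(𝟙 + φ)^*`-eigenspace for `μ` on `Hᵈ(A)` into the
`(𝟙 + ψ_K)^*`-eigenspace for `μ` on `Hᵈ(A × A)` (contravariance and `psiK_comp_linComb`).
[cite: vanGeemen1994HodgeAV, 4.9 and Thm. 6.12] -/
theorem map_linComb_mem_eigenspace (φ : A ⟶ A) {d : ℕ} {μ : ℂ} {y : complexBetti A.X d}
    (hy : y ∈ Module.End.eigenspace (complexBetti.map (𝟙 A + φ).hom.hom.hom d).hom μ) (a b : ℕ) :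
    complexBetti.map (a • fst A A + b • snd A A).hom.hom.hom d y ∈
      Module.End.eigenspace
        (complexBetti.map (𝟙 (A.prod A) + prodLift (fst A A ≫ φ) (snd A A ≫ φ)).hom.hom.hom d).hom μ := by
  rw [Module.End.mem_eigenspace_iff] at hy ⊢
  have hy' : complexBetti.map (𝟙 A + φ).hom.hom.hom d y = μ • y := hy
  show complexBetti.map _ d (complexBetti.map _ d y) = μ • complexBetti.map _ d y
  rw [complexBetti_map_map_hom, psiK_comp_linComb, ← complexBetti_map_map_hom, hy', map_smul]

/-- **`F`-part, geometric input**: `(𝟙 + ψ_F)^* (a • fst + b • snd)^* y = ((a+b) • fst + (ta+b) • snd)^* y`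
(contravariance and `psiF_comp_linComb`). [cite: vanGeemen1994HodgeAV, 4.9 and Thm. 6.12] -/
theorem map_one_add_psiF_map_linComb (t a b : ℕ) {d : ℕ} (y : complexBetti A.X d) :
    complexBetti.map (𝟙 (A.prod A) + prodLift ((t : ℤ) • snd A A) (fst A A)).hom.hom.hom d
        (complexBetti.map (a • fst A A + b • snd A A).hom.hom.hom d y) =
      complexBetti.map ((a + b) • fst A A + (t * a + b) • snd A A).hom.hom.hom d y := by
  rw [complexBetti_map_map_hom, psiF_comp_linComb]

/-- **The section kills the twist**: `ι^* (fst + b • snd)^* y = y` for `ι = (𝟙, 0)`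
(`ι ≫ (fst + b • snd) = 𝟙`). [folklore] -/
theorem map_section_map_linComb (b : ℕ) {d : ℕ} (y : complexBetti A.X d) :
    complexBetti.map (prodLift (𝟙 A) (0 : A ⟶ A)).hom.hom.hom d
        (complexBetti.map ((1 : ℕ) • fst A A + b • snd A A).hom.hom.hom d y) = y := by
  rw [complexBetti_map_map_hom, section_comp_linComb, one_smul]
  show complexBetti.map (𝟙 A.X) d y = y
  rw [complexBetti.map_id]
  rfl

end Geometry

end Summit.HodgeConjecture.HodgeConjecture.Theorems.WeilSixfoldsSqrtMinus7.RealQuadraticBaseChange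

end
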